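import Literature.NumberTheory.LFunctions.Zhang2022.RepairFormMatrix
import Literature.NumberTheory.LFunctions.Zhang2022.RepairSection9Slopes

/-!
# Zhang (2022) §18-margin repair rung: `LDLᴴ` pivots of the margin matrix in slope arithmetic

Trunk T-ANT (NumberTheory/LFunctions). Companion of `RepairFormMatrix.lean` (the margin of Y. Zhang,
arXiv:2211.02515v1 [Zhang2022LandauSiegel], (2.32)/§18, as the Hermitian form of `QMOf …`) and
`RepairSlopeArith.lean`. For the LOCAL cover annex (D-0077) a leaf must certify
`QMOf(entries(t)) − m e₀e₀ᵀ ⪰ 0` for EVERY `t` of a cell. Entrywise interval tests (Gershgorin or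
Rump type) forget that the entries move TOGETHER along the one-parameter family and tolerate an
entry radius of `≈ 10⁻⁴` only (the matrix is near-degenerate by design), i.e. cells of width
`≈ 10⁻⁵`. This file keeps the correlation: it runs the `4 × 4` Hermitian `LDLᴴ` elimination on
SLOPE FORMS of the entries, so that the pivots `d₁(t), …, d₄(t)` are themselves first-order
centred forms in `t`, and checks `dᵢ > 0` on the cell from their enclosures:

* exact pivots `piv1 … piv4` (and multipliers `mul21`, `mul31`, `mul32`) of the `QMOf` layout,
  the factor `ldlL`, and **`QMOf_eq_ldl`** (`Q = L·diag(d)·Lᴴ` when the diagonal is real,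
  `c₂₁ = c̄₁₂` and `d₁d₂d₃ ≠ 0`), **`QMOf_posSemidef_of_pivots`**;
* `SCB.reS` (real part of a complex slope form; sound for real-valued functions),
  slope mirrors `piv1S … piv4S` with `smem_piv…`, the leaf test `pivotsPos` and
  **`posSemidef_on_cell_of_pivotsPos`**: `∀ t ∈ T`, `QMOf(entries t) ⪰ 0`.

No statement about the manuscript's Theorems 1–2; no facts, no axioms beyond the standard three.
-/

noncomputable section

open Complex ComplexConjugate Matrix
open scoped ComplexOrder
open Literature.Analysis.ValidatedNumerics.Numerics

namespace Literature.NumberTheory.LFunctions.Zhang2022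

/-! ### Exact pivots of the `QMOf` layout -/

section Pivots

variable (r11 r22 r33 : ℝ) (c12 c34 F20 F21 F30 F31 : ℂ) (m : ℚ)

/-- first pivot `d₁ = c₁₁ − m` [folklore] -/
def piv1 : ℝ := r11 - m
/-- second pivot `d₂ = c₂₂ − |c₁₂|²/d₁` [folklore] -/
def piv2 : ℝ := r22 - Complex.normSq c12 / piv1 r11 m
/-- multiplier numerator `m₂₁ = F₂₁ − F₂₀ c̄₁₂/d₁` [folklore] -/
def mul21 : ℂ := F21 - F20 * conj c12 * ((1 / piv1 r11 m : ℝ) : ℂ)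
/-- multiplier numerator `m₃₁ = F₃₁ − F₃₀ c̄₁₂/d₁` [folklore] -/
def mul31 : ℂ := F31 - F30 * conj c12 * ((1 / piv1 r11 m : ℝ) : ℂ)
/-- third pivot `d₃ = c₃₃ − |F₂₀|²/d₁ − |m₂₁|²/d₂` [folklore] -/
def piv3 : ℝ := r33 - Complex.normSq F20 / piv1 r11 m
  - Complex.normSq (mul21 r11 c12 F20 F21 m) / piv2 r11 r22 c12 m
/-- multiplier numerator `m₃₂ = c₃₄ − F₃₀F̄₂₀/d₁ − m₃₁ m̄₂₁/d₂` [folklore] -/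
def mul32 : ℂ := c34 - F30 * conj F20 * ((1 / piv1 r11 m : ℝ) : ℂ)
  - mul31 r11 c12 F30 F31 m * conj (mul21 r11 c12 F20 F21 m) * ((1 / piv2 r11 r22 c12 m : ℝ) : ℂ)
/-- fourth pivot `d₄ = c₂₂ − |F₃₀|²/d₁ − |m₃₁|²/d₂ − |m₃₂|²/d₃` (`c₄₄ = c₂₂`) [folklore] -/
def piv4 : ℝ := r22 - Complex.normSq F30 / piv1 r11 m
  - Complex.normSq (mul31 r11 c12 F30 F31 m) / piv2 r11 r22 c12 m
  - Complex.normSq (mul32 r11 r22 c12 c34 F20 F21 F30 F31 m) / piv3 r11 r22 r33 c12 F20 F21 m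

end Pivots

/-! ### The abstract `LDLᴴ` identity for the `QMOf` layout -/

/-- unit lower-triangular factor from the multipliers: rows `(1), (c₁₂u₁, 1), (F₂₀u₁, n₂₁u₂, 1),
(F₃₀u₁, n₃₁u₂, n₃₂u₃, 1)` (`uᵢ = 1/dᵢ`). [folklore] -/
def ldlL (c12 F20 F30 n21 n31 n32 : ℂ) (u1 u2 u3 : ℝ) : Matrix (Fin 4) (Fin 4) ℂ :=
  !![1, 0, 0, 0;
     c12 * (u1 : ℂ), 1, 0, 0;
     F20 * (u1 : ℂ), n21 * (u2 : ℂ), 1, 0;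
     F30 * (u1 : ℂ), n31 * (u2 : ℂ), n32 * (u3 : ℂ), 1]

/-- the pivot vector as complex numbers [folklore] -/
def ldlD (d1 d2 d3 d4 : ℝ) : Fin 4 → ℂ := ![(d1 : ℂ), (d2 : ℂ), (d3 : ℂ), (d4 : ℂ)]

/-- **Abstract `LDLᴴ` identity**: if real `dᵢ`, `uᵢ` with `uᵢdᵢ = 1` (`i ≤ 3`) and complex `n₂₁, n₃₁,
n₃₂` satisfy the seven elimination relations, then `QMOf r₁₁ c̄₁₂ c₁₂ r₂₂ r₃₃ c₃₄ F·· m = L·diag(d)·Lᴴ`.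
[cite: Rump2006, §1] -/
theorem QMOf_eq_ldl_of_rel {r11 r22 r33 : ℝ} {c12 c34 F20 F21 F30 F31 : ℂ} {m : ℚ}
    {d1 d2 d3 d4 u1 u2 u3 : ℝ} {n21 n31 n32 : ℂ}
    (i1 : u1 * d1 = 1) (i2 : u2 * d2 = 1) (i3 : u3 * d3 = 1)
    (e1 : (r11 : ℂ) - (m : ℂ) = d1)
    (e2 : (r22 : ℂ) = d2 + c12 * conj c12 * u1)
    (e21 : F21 = n21 + F20 * conj c12 * u1)
    (e31 : F31 = n31 + F30 * conj c12 * u1)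
    (e3 : (r33 : ℂ) = d3 + F20 * conj F20 * u1 + n21 * conj n21 * u2)
    (e32 : c34 = n32 + F30 * conj F20 * u1 + n31 * conj n21 * u2)
    (e4 : (r22 : ℂ) = d4 + F30 * conj F30 * u1 + n31 * conj n31 * u2 + n32 * conj n32 * u3) :
    QMOf (r11 : ℂ) (conj c12) c12 (r22 : ℂ) (r33 : ℂ) c34 F20 F21 F30 F31 m
      = ldlL c12 F20 F30 n21 n31 n32 u1 u2 u3 * diagonal (ldlD d1 d2 d3 d4)
        * (ldlL c12 F20 F30 n21 n31 n32 u1 u2 u3)ᴴ := by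
  have i1c : (u1 : ℂ) * (d1 : ℂ) = 1 := by exact_mod_cast i1
  have i2c : (u2 : ℂ) * (d2 : ℂ) = 1 := by exact_mod_cast i2
  have i3c : (u3 : ℂ) * (d3 : ℂ) = 1 := by exact_mod_cast i3
  have e21c : conj F21 = conj n21 + conj F20 * c12 * u1 := by
    rw [e21]; simp only [map_add, map_mul, Complex.conj_conj, Complex.conj_ofReal]
  have e31c : conj F31 = conj n31 + conj F30 * c12 * u1 := by
    rw [e31]; simp only [map_add, map_mul, Complex.conj_conj, Complex.conj_ofReal]
  have e32c : conj c34 = conj n32 + conj F30 * F20 * u1 + conj n31 * n21 * u2 := by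
    rw [e32]; simp only [map_add, map_mul, Complex.conj_conj, Complex.conj_ofReal]
  ext i j
  rw [Matrix.mul_apply]
  simp only [Matrix.mul_diagonal, Matrix.conjTranspose_apply, Fin.sum_univ_four]
  fin_cases i <;> fin_cases j <;>
    simp [QMOf, ldlL, ldlD, Complex.conj_ofReal]
  · linear_combination e1
  · linear_combination (-(conj c12)) * i1c
  · linear_combination (-(conj F20)) * i1c
  · linear_combination (-(conj F30)) * i1c
  · linear_combination (-c12) * i1c
  · linear_combination e2 - (c12 * conj c12 * u1) * i1c
  · linear_combination e21c - (conj F20 * c12 * u1) * i1c - (conj n21) * i2c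
  · linear_combination e31c - (conj F30 * c12 * u1) * i1c - (conj n31) * i2c
  · linear_combination (-F20) * i1c
  · linear_combination e21 - (F20 * conj c12 * u1) * i1c - n21 * i2c
  · linear_combination e3 - (F20 * conj F20 * u1) * i1c - (n21 * conj n21 * u2) * i2c
  · linear_combination e32c - (F20 * conj F30 * u1) * i1c - (n21 * conj n31 * u2) * i2c - (conj n32) * i3c
  · linear_combination (-F30) * i1c
  · linear_combination e31 - (F30 * conj c12 * u1) * i1c - n31 * i2c
  · linear_combination e32 - (F30 * conj F20 * u1) * i1c - (n31 * conj n21 * u2) * i2c - n32 * i3c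
  · linear_combination e4 - (F30 * conj F30 * u1) * i1c - (n31 * conj n31 * u2) * i2c - (n32 * conj n32 * u3) * i3c

/-- **`LDLᴴ` factorisation with the computed pivots** (first three pivots non-zero).
[cite: Rump2006, §1] -/
theorem QMOf_eq_ldl (r11 r22 r33 : ℝ) (c12 c34 F20 F21 F30 F31 : ℂ) (m : ℚ)
    (h1 : piv1 r11 m ≠ 0) (h2 : piv2 r11 r22 c12 m ≠ 0) (h3 : piv3 r11 r22 r33 c12 F20 F21 m ≠ 0) :
    QMOf (r11 : ℂ) (conj c12) c12 (r22 : ℂ) (r33 : ℂ) c34 F20 F21 F30 F31 m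
      = ldlL c12 F20 F30 (mul21 r11 c12 F20 F21 m) (mul31 r11 c12 F30 F31 m)
            (mul32 r11 r22 c12 c34 F20 F21 F30 F31 m)
            (1 / piv1 r11 m) (1 / piv2 r11 r22 c12 m) (1 / piv3 r11 r22 r33 c12 F20 F21 m)
        * diagonal (ldlD (piv1 r11 m) (piv2 r11 r22 c12 m) (piv3 r11 r22 r33 c12 F20 F21 m)
            (piv4 r11 r22 r33 c12 c34 F20 F21 F30 F31 m))
        * (ldlL c12 F20 F30 (mul21 r11 c12 F20 F21 m) (mul31 r11 c12 F30 F31 m)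
            (mul32 r11 r22 c12 c34 F20 F21 F30 F31 m)
            (1 / piv1 r11 m) (1 / piv2 r11 r22 c12 m) (1 / piv3 r11 r22 r33 c12 F20 F21 m))ᴴ := by
  refine QMOf_eq_ldl_of_rel (one_div_mul_cancel h1) (one_div_mul_cancel h2) (one_div_mul_cancel h3)
    ?_ ?_ ?_ ?_ ?_ ?_ ?_
  · unfold piv1; push_cast; ring
  · rw [mul_conj']; unfold piv2; simp only [Complex.normSq_eq_norm_sq]; push_cast; ring
  · unfold mul21; push_cast; ring
  · unfold mul31; push_cast; ring
  · rw [mul_conj', mul_conj']; unfold piv3; simp only [Complex.normSq_eq_norm_sq]; push_cast; ring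
  · unfold mul32; push_cast; ring
  · rw [mul_conj', mul_conj', mul_conj']; unfold piv4; simp only [Complex.normSq_eq_norm_sq]
    push_cast; ring

/-- **Positive semidefiniteness from the pivots** (real diagonal, `c₂₁ = c̄₁₂`): `d₁, d₂, d₃ > 0` and
`d₄ ≥ 0` give `QMOf … ⪰ 0`. [cite: Rump2006, §1] -/
theorem QMOf_posSemidef_of_pivots (r11 r22 r33 : ℝ) (c12 c34 F20 F21 F30 F31 : ℂ) (m : ℚ)
    (h1 : 0 < piv1 r11 m) (h2 : 0 < piv2 r11 r22 c12 m) (h3 : 0 < piv3 r11 r22 r33 c12 F20 F21 m)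
    (h4 : 0 ≤ piv4 r11 r22 r33 c12 c34 F20 F21 F30 F31 m) :
    (QMOf (r11 : ℂ) (conj c12) c12 (r22 : ℂ) (r33 : ℂ) c34 F20 F21 F30 F31 m).PosSemidef := by
  rw [QMOf_eq_ldl r11 r22 r33 c12 c34 F20 F21 F30 F31 m h1.ne' h2.ne' h3.ne']
  refine Matrix.PosSemidef.mul_mul_conjTranspose_same (Matrix.PosSemidef.diagonal ?_) _
  intro i
  fin_cases i
  · simpa [ldlD] using Complex.zero_le_real.2 h1.le
  · simpa [ldlD] using Complex.zero_le_real.2 h2.le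
  · simpa [ldlD] using Complex.zero_le_real.2 h3.le
  · simpa [ldlD] using Complex.zero_le_real.2 h4

/-! ### The pivots in slope arithmetic -/

variable {T : FI} {c : ℚ}

/-- real part of a complex slope form [cite: Moore1966, §4.4] -/
def SCB.reS (Z : SCB) : SFI := ⟨Z.rng.re, Z.ctr.re, Z.slp.re⟩

/-- soundness of `reS`: the real part of `f` (the variable is real). [cite: Moore1966, §4.4] -/
theorem SCB.mem_reS {f : ℝ → ℂ} {Z : SCB} (hf : SCB.Mem T c f Z) :
    SFI.Mem T c (fun t => (f t).re) Z.reS := by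
  refine ⟨fun t ht => (hf.1 t ht).1, hf.2.1.1, fun t ht => ?_⟩
  obtain ⟨s, hs, es⟩ := hf.2.2 t ht
  refine ⟨s.re, hs.1, ?_⟩
  have := congrArg Complex.re es
  simpa [Complex.sub_re, Complex.mul_re] using this

/-- `|f|²` as a real slope form: `Re(f·f̄)`. [cite: Moore1966, §4.4] -/
def SCB.normSqS (Z : SCB) : SFI := (Z.mul Z.conj).reS

/-- soundness of `normSqS` [cite: Moore1966, §4.4] -/
theorem SCB.mem_normSqS {f : ℝ → ℂ} {Z : SCB} (hf : SCB.Mem T c f Z) :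
    SFI.Mem T c (fun t => Complex.normSq (f t)) Z.normSqS := by
  have h := SCB.mem_reS (SCB.mem_mul hf (SCB.mem_conj hf))
  refine h.congr fun t => ?_
  show Complex.normSq (f t) = (f t * (starRingEnd ℂ) (f t)).re
  rw [Complex.mul_conj]; simp

/-- The ten exact entry functions of the margin matrix along a one-parameter family (diagonal
entries real). [cite: Zhang2022LandauSiegel, (2.32), §18] -/
structure EntryF where
  /-- `c₁₁(t)` -/ r11 : ℝ → ℝ
  /-- `c₂₂(t) = c₄₄(t)` -/ r22 : ℝ → ℝ
  /-- `c₃₃(t)` -/ r33 : ℝ → ℝ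
  /-- `c₁₂(t)` -/ c12 : ℝ → ℂ
  /-- `c₃₄(t)` -/ c34 : ℝ → ℂ
  /-- `F₂₀(t)` -/ F20 : ℝ → ℂ
  /-- `F₂₁(t)` -/ F21 : ℝ → ℂ
  /-- `F₃₀(t)` -/ F30 : ℝ → ℂ
  /-- `F₃₁(t)` -/ F31 : ℝ → ℂ

/-- Slope forms for the ten entries. [cite: Moore1966, §4.4] -/
structure EntryS where
  /-- slope form of `c₁₁` -/ r11 : SFI
  /-- slope form of `c₂₂ = c₄₄` -/ r22 : SFI
  /-- slope form of `c₃₃` -/ r33 : SFI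
  /-- slope form of `c₁₂` -/ c12 : SCB
  /-- slope form of `c₃₄` -/ c34 : SCB
  /-- slope form of `F₂₀` -/ F20 : SCB
  /-- slope form of `F₂₁` -/ F21 : SCB
  /-- slope form of `F₃₀` -/ F30 : SCB
  /-- slope form of `F₃₁` -/ F31 : SCB

/-- the entry slope forms enclose the entry functions on the cell [cite: Moore1966, §4.4] -/
def EntryS.Mem (T : FI) (c : ℚ) (E : EntryF) (S : EntryS) : Prop :=
  SFI.Mem T c E.r11 S.r11 ∧ SFI.Mem T c E.r22 S.r22 ∧ SFI.Mem T c E.r33 S.r33 ∧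
  SCB.Mem T c E.c12 S.c12 ∧ SCB.Mem T c E.c34 S.c34 ∧ SCB.Mem T c E.F20 S.F20 ∧
  SCB.Mem T c E.F21 S.F21 ∧ SCB.Mem T c E.F30 S.F30 ∧ SCB.Mem T c E.F31 S.F31

/-- the matrix family along the cell [cite: Zhang2022LandauSiegel, (2.32), §18] -/
def EntryF.Q (E : EntryF) (m : ℚ) (t : ℝ) : Matrix (Fin 4) (Fin 4) ℂ :=
  QMOf (E.r11 t : ℂ) (conj (E.c12 t)) (E.c12 t) (E.r22 t : ℂ) (E.r33 t : ℂ) (E.c34 t)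
    (E.F20 t) (E.F21 t) (E.F30 t) (E.F31 t) m

/-- The four pivot slope forms (with the three reciprocal slope forms computed on the way).
[cite: Rump2006, §1] -/
structure PivS where
  /-- `d₁` -/ d1 : SFI
  /-- `d₂` -/ d2 : SFI
  /-- `d₃` -/ d3 : SFI
  /-- `d₄` -/ d4 : SFI

/-- **The elimination in slope arithmetic** (mirrors `piv1 … piv4`, `mul21`, `mul31`, `mul32`).
[cite: Rump2006, §1] -/
def EntryS.pivots (S : EntryS) (m : ℚ) : PivS :=
  let d1 := S.r11.sub (SFI.const (FI.ofRat m))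
  let u1 := d1.recip
  let d2 := S.r22.sub (S.c12.normSqS.mul u1)
  let u2 := d2.recip
  let n21 := S.F21.sub ((S.F20.mul S.c12.conj).mulR u1)
  let n31 := S.F31.sub ((S.F30.mul S.c12.conj).mulR u1)
  let d3 := (S.r33.sub (S.F20.normSqS.mul u1)).sub (n21.normSqS.mul u2)
  let u3 := d3.recip
  let n32 := (S.c34.sub ((S.F30.mul S.F20.conj).mulR u1)).sub ((n31.mul n21.conj).mulR u2)
  let d4 := ((S.r22.sub (S.F30.normSqS.mul u1)).sub (n31.normSqS.mul u2)).sub (n32.normSqS.mul u3)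
  ⟨d1, d2, d3, d4⟩

/-- validity flags of the elimination (the three reciprocals). [folklore] -/
def EntryS.pivotsOK (S : EntryS) (m : ℚ) : Bool :=
  let d1 := S.r11.sub (SFI.const (FI.ofRat m))
  let u1 := d1.recip
  let d2 := S.r22.sub (S.c12.normSqS.mul u1)
  let u2 := d2.recip
  let n21 := S.F21.sub ((S.F20.mul S.c12.conj).mulR u1)
  let d3 := (S.r33.sub (S.F20.normSqS.mul u1)).sub (n21.normSqS.mul u2)
  d1.recipSOK && d2.recipSOK && d3.recipSOK

/-- **Soundness of the slope elimination**: the four pivot slope forms enclose the exact pivots.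
[cite: Rump2006, §1] -/
theorem EntryS.mem_pivots {E : EntryF} {S : EntryS} (hS : EntryS.Mem T c E S) {m : ℚ}
    (hok : S.pivotsOK m = true) :
    SFI.Mem T c (fun t => piv1 (E.r11 t) m) (S.pivots m).d1 ∧
    SFI.Mem T c (fun t => piv2 (E.r11 t) (E.r22 t) (E.c12 t) m) (S.pivots m).d2 ∧
    SFI.Mem T c (fun t => piv3 (E.r11 t) (E.r22 t) (E.r33 t) (E.c12 t) (E.F20 t) (E.F21 t) m)
      (S.pivots m).d3 ∧
    SFI.Mem T c (fun t => piv4 (E.r11 t) (E.r22 t) (E.r33 t) (E.c12 t) (E.c34 t) (E.F20 t) (E.F21 t)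
      (E.F30 t) (E.F31 t) m) (S.pivots m).d4 := by
  obtain ⟨h11, h22, h33, h12, h34, hF20, hF21, hF30, hF31⟩ := hS
  simp only [EntryS.pivotsOK, Bool.and_eq_true] at hok
  obtain ⟨⟨ok1, ok2⟩, ok3⟩ := hok
  -- d1
  have hd1 : SFI.Mem T c (fun t => piv1 (E.r11 t) m) (S.r11.sub (SFI.const (FI.ofRat m))) := by
    have := SFI.mem_sub h11 (SFI.mem_const (T := T) (c := c) (FI.mem_ofRat m))
    exact SFI.Mem.congr this fun t => by unfold piv1; rfl
  have hu1 := SFI.mem_recip hd1 ok1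
  -- d2
  have hd2 : SFI.Mem T c (fun t => piv2 (E.r11 t) (E.r22 t) (E.c12 t) m)
      (S.r22.sub (S.c12.normSqS.mul (S.r11.sub (SFI.const (FI.ofRat m))).recip)) := by
    have := SFI.mem_sub h22 (SFI.mem_mul (SCB.mem_normSqS h12) hu1)
    exact SFI.Mem.congr this fun t => by unfold piv2; ring
  have hu2 := SFI.mem_recip hd2 ok2
  -- n21, n31
  have hn21 : SCB.Mem T c (fun t => mul21 (E.r11 t) (E.c12 t) (E.F20 t) (E.F21 t) m)
      (S.F21.sub ((S.F20.mul S.c12.conj).mulR (S.r11.sub (SFI.const (FI.ofRat m))).recip)) := by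
    have := SCB.mem_sub hF21 (SCB.mem_mulR (SCB.mem_mul hF20 (SCB.mem_conj h12)) hu1)
    exact this.congr fun t => by unfold mul21; rfl
  have hn31 : SCB.Mem T c (fun t => mul31 (E.r11 t) (E.c12 t) (E.F30 t) (E.F31 t) m)
      (S.F31.sub ((S.F30.mul S.c12.conj).mulR (S.r11.sub (SFI.const (FI.ofRat m))).recip)) := by
    have := SCB.mem_sub hF31 (SCB.mem_mulR (SCB.mem_mul hF30 (SCB.mem_conj h12)) hu1)
    exact this.congr fun t => by unfold mul31; rfl
  -- d3
  have hd3 : SFI.Mem T c (fun t => piv3 (E.r11 t) (E.r22 t) (E.r33 t) (E.c12 t) (E.F20 t) (E.F21 t) m)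
      (((S.r33.sub (S.F20.normSqS.mul (S.r11.sub (SFI.const (FI.ofRat m))).recip)).sub
        ((S.F21.sub ((S.F20.mul S.c12.conj).mulR (S.r11.sub (SFI.const (FI.ofRat m))).recip)).normSqS.mul
          (S.r22.sub (S.c12.normSqS.mul (S.r11.sub (SFI.const (FI.ofRat m))).recip)).recip))) := by
    have := SFI.mem_sub (SFI.mem_sub h33 (SFI.mem_mul (SCB.mem_normSqS hF20) hu1))
      (SFI.mem_mul (SCB.mem_normSqS hn21) hu2)
    exact SFI.Mem.congr this fun t => by unfold piv3; ring
  have hu3 := SFI.mem_recip hd3 ok3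
  -- n32
  have hn32 := SCB.mem_sub (SCB.mem_sub h34 (SCB.mem_mulR (SCB.mem_mul hF30 (SCB.mem_conj hF20)) hu1))
    (SCB.mem_mulR (SCB.mem_mul hn31 (SCB.mem_conj hn21)) hu2)
  have hn32' : SCB.Mem T c (fun t => mul32 (E.r11 t) (E.r22 t) (E.c12 t) (E.c34 t) (E.F20 t) (E.F21 t)
      (E.F30 t) (E.F31 t) m) _ := hn32.congr fun t => by unfold mul32; rfl
  -- d4
  have hd4 := SFI.mem_sub (SFI.mem_sub (SFI.mem_sub h22 (SFI.mem_mul (SCB.mem_normSqS hF30) hu1))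
    (SFI.mem_mul (SCB.mem_normSqS hn31) hu2)) (SFI.mem_mul (SCB.mem_normSqS hn32') hu3)
  have hd4' : SFI.Mem T c (fun t => piv4 (E.r11 t) (E.r22 t) (E.r33 t) (E.c12 t) (E.c34 t) (E.F20 t)
      (E.F21 t) (E.F30 t) (E.F31 t) m) _ :=
    SFI.Mem.congr hd4 fun t => by unfold piv4; ring
  exact ⟨hd1, hd2, hd3, hd4'⟩

/-- **The leaf test**: elimination valid and the centred-form enclosures of `d₁, d₂, d₃` positive,
of `d₄` non-negative, on the whole cell. [cite: Rump2006, §1] -/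
def EntryS.pivotsPos (S : EntryS) (m : ℚ) (T : FI) (c : ℚ) : Bool :=
  S.pivotsOK m && decide (0 < ((S.pivots m).d1.encl T c).lo) && decide (0 < ((S.pivots m).d2.encl T c).lo)
    && decide (0 < ((S.pivots m).d3.encl T c).lo) && decide (0 ≤ ((S.pivots m).d4.encl T c).lo)

/-- from an enclosure with positive lower endpoint to positivity [cite: Moore1966, Theorem 3.1] -/
private theorem pos_of_encl {x : ℝ} {X : FI} (hx : FI.mem x X) (h : 0 < X.lo) : 0 < x :=
  FI.pos_of_lo_pos hx h

/-- from an enclosure with non-negative lower endpoint to non-negativity [cite: Moore1966, Theorem 3.1] -/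
private theorem nonneg_of_encl {x : ℝ} {X : FI} (hx : FI.mem x X) (h : 0 ≤ X.lo) : 0 ≤ x := by
  have h1 := FI.lo_div_le hx
  have h2 : (0 : ℝ) ≤ (X.lo : ℝ) / SC := div_nonneg (by exact_mod_cast h) SC_pos.le
  linarith

/-- **Positive semidefiniteness on a whole cell from the slope-form pivots.** If the entry slope
forms enclose the entry functions on `T` and the leaf test passes, then `Q(t) ⪰ 0` for every
`t ∈ T`. [cite: Rump2006, §1] -/
theorem EntryS.posSemidef_on_cell {E : EntryF} {S : EntryS} (hS : EntryS.Mem T c E S) {m : ℚ}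
    (h : S.pivotsPos m T c = true) {t : ℝ} (ht : FI.mem t T) : (E.Q m t).PosSemidef := by
  simp only [EntryS.pivotsPos, Bool.and_eq_true, decide_eq_true_eq] at h
  obtain ⟨⟨⟨⟨hok, h1⟩, h2⟩, h3⟩, h4⟩ := h
  obtain ⟨m1, m2, m3, m4⟩ := EntryS.mem_pivots hS hok
  exact QMOf_posSemidef_of_pivots _ _ _ _ _ _ _ _ _ m
    (pos_of_encl (SFI.mem_encl m1 ht) h1) (pos_of_encl (SFI.mem_encl m2 ht) h2)
    (pos_of_encl (SFI.mem_encl m3 ht) h3) (nonneg_of_encl (SFI.mem_encl m4 ht) h4)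

/-- **The margin floor on a whole cell**: with the leaf test passed, for every `t ∈ T` and every
`(w₂, w₃, w₄)` the margin (𝔠₁-block + 𝔠₂-block + 2 Re L of the entries at `t`) is `≥ m`.
[cite: Zhang2022LandauSiegel, (2.32), §18] -/
theorem EntryS.blocks_ge_on_cell {E : EntryF} {S : EntryS} (hS : EntryS.Mem T c E S) {m : ℚ}
    (h : S.pivotsPos m T c = true) {t : ℝ} (ht : FI.mem t T) (w2 w3 w4 : ℂ) :
    (m : ℝ) ≤ ((E.r11 t : ℂ) + w2 * conj (E.c12 t) + conj w2 * E.c12 t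
          + (Complex.normSq w2 : ℂ) * (E.r22 t : ℂ)).re
        + ((Complex.normSq w3 : ℂ) * (E.r33 t : ℂ) + w3 * conj w4 * E.c34 t
            + w4 * conj w3 * conj (E.c34 t) + (Complex.normSq w4 : ℂ) * (E.r22 t : ℂ)).re
        + 2 * (conj w3 * E.F20 t + conj w3 * w2 * E.F21 t + conj w4 * E.F30 t
            + conj w4 * w2 * E.F31 t).re :=
  blocks_ge_of_QMOf_posSemidef (EntryS.posSemidef_on_cell hS h ht) w2 w3 w4

/-! ### Sharpened slope forms: the centred-form enclosure replaces the naive range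

The `rng` component of a slope form is the NATURAL interval extension; for quantities obtained by
cancellation (the pivots `d₃, d₄` are differences of `O(1)` terms of size `O(10⁻²)`) it may straddle `0`
although the centred-form enclosure `ctr + slp·(T − c)` is tight. `sharp` intersects the two, so that
the reciprocal (which needs a range bounded away from `0`) and the products downstream see the tight
range. -/

/-- intersection of two enclosures of the same number [cite: Moore1966, Theorem 3.1] -/
def interFI (I J : FI) : FI := ⟨max I.lo J.lo, min I.hi J.hi⟩

/-- soundness of `interFI` [cite: Moore1966, Theorem 3.1] -/
theorem mem_interFI {x : ℝ} {I J : FI} (h1 : FI.mem x I) (h2 : FI.mem x J) : FI.mem x (interFI I J) := by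
  refine ⟨?_, ?_⟩
  · simp only [interFI]; push_cast; exact max_le h1.1 h2.1
  · simp only [interFI]; push_cast; exact le_min h1.2 h2.2

/-- **sharpened real slope form**: range `:= rng ∩ (ctr + slp·(T − c))`. [cite: Moore1966, §4.4] -/
def SFI.sharp (Z : SFI) (T : FI) (c : ℚ) : SFI := ⟨interFI Z.rng (Z.encl T c), Z.ctr, Z.slp⟩

/-- soundness of `SFI.sharp` [cite: Moore1966, §4.4] -/
theorem SFI.mem_sharp {f : ℝ → ℝ} {Z : SFI} (h : SFI.Mem T c f Z) : SFI.Mem T c f (Z.sharp T c) :=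
  ⟨fun t ht => mem_interFI (h.1 t ht) (SFI.mem_encl h ht), h.2.1, h.2.2⟩

/-- **sharpened complex slope form**. [cite: Moore1966, §4.4] -/
def SCB.sharp (Z : SCB) (T : FI) (c : ℚ) : SCB :=
  ⟨⟨interFI Z.rng.re (Z.encl T c).re, interFI Z.rng.im (Z.encl T c).im⟩, Z.ctr, Z.slp⟩

/-- soundness of `SCB.sharp` [cite: Moore1966, §4.4] -/
theorem SCB.mem_sharp {f : ℝ → ℂ} {Z : SCB} (h : SCB.Mem T c f Z) : SCB.Mem T c f (Z.sharp T c) :=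
  ⟨fun t ht => ⟨mem_interFI (h.1 t ht).1 (SCB.mem_encl h ht).1, mem_interFI (h.1 t ht).2 (SCB.mem_encl h ht).2⟩,
    h.2.1, h.2.2⟩

/-- **The elimination in slope arithmetic with sharpening** of every entry and intermediate (same algebra
as `EntryS.pivots`). [cite: Rump2006, §1] -/
def EntryS.pivotsS (S : EntryS) (m : ℚ) (T : FI) (c : ℚ) : PivS :=
  let r11 := S.r11.sharp T c
  let r22 := S.r22.sharp T c
  let r33 := S.r33.sharp T c
  let c12 := S.c12.sharp T c
  let c34 := S.c34.sharp T c
  let F20 := S.F20.sharp T c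
  let F21 := S.F21.sharp T c
  let F30 := S.F30.sharp T c
  let F31 := S.F31.sharp T c
  let d1 := (r11.sub (SFI.const (FI.ofRat m))).sharp T c
  let u1 := d1.recip.sharp T c
  let d2 := (r22.sub (c12.normSqS.mul u1)).sharp T c
  let u2 := d2.recip.sharp T c
  let n21 := (F21.sub ((F20.mul c12.conj).mulR u1)).sharp T c
  let n31 := (F31.sub ((F30.mul c12.conj).mulR u1)).sharp T c
  let d3 := ((r33.sub (F20.normSqS.mul u1)).sub (n21.normSqS.mul u2)).sharp T c
  let u3 := d3.recip.sharp T c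
  let n32 := ((c34.sub ((F30.mul F20.conj).mulR u1)).sub ((n31.mul n21.conj).mulR u2)).sharp T c
  let d4 := ((r22.sub (F30.normSqS.mul u1)).sub (n31.normSqS.mul u2)).sub (n32.normSqS.mul u3)
  ⟨d1, d2, d3, d4⟩

/-- validity flags of the sharpened elimination (the three reciprocals). [folklore] -/
def EntryS.pivotsSOK (S : EntryS) (m : ℚ) (T : FI) (c : ℚ) : Bool :=
  let r11 := S.r11.sharp T c
  let r22 := S.r22.sharp T c
  let r33 := S.r33.sharp T c
  let c12 := S.c12.sharp T c
  let F20 := S.F20.sharp T c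
  let F21 := S.F21.sharp T c
  let d1 := (r11.sub (SFI.const (FI.ofRat m))).sharp T c
  let u1 := d1.recip.sharp T c
  let d2 := (r22.sub (c12.normSqS.mul u1)).sharp T c
  let u2 := d2.recip.sharp T c
  let n21 := (F21.sub ((F20.mul c12.conj).mulR u1)).sharp T c
  let d3 := ((r33.sub (F20.normSqS.mul u1)).sub (n21.normSqS.mul u2)).sharp T c
  d1.recipSOK && d2.recipSOK && d3.recipSOK

/-- **Soundness of the sharpened elimination.** [cite: Rump2006, §1] -/
theorem EntryS.mem_pivotsS {E : EntryF} {S : EntryS} (hS : EntryS.Mem T c E S) {m : ℚ}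
    (hok : S.pivotsSOK m T c = true) :
    SFI.Mem T c (fun t => piv1 (E.r11 t) m) (S.pivotsS m T c).d1 ∧
    SFI.Mem T c (fun t => piv2 (E.r11 t) (E.r22 t) (E.c12 t) m) (S.pivotsS m T c).d2 ∧
    SFI.Mem T c (fun t => piv3 (E.r11 t) (E.r22 t) (E.r33 t) (E.c12 t) (E.F20 t) (E.F21 t) m)
      (S.pivotsS m T c).d3 ∧
    SFI.Mem T c (fun t => piv4 (E.r11 t) (E.r22 t) (E.r33 t) (E.c12 t) (E.c34 t) (E.F20 t) (E.F21 t)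
      (E.F30 t) (E.F31 t) m) (S.pivotsS m T c).d4 := by
  obtain ⟨h11, h22, h33, h12, h34, hF20, hF21, hF30, hF31⟩ := hS
  replace h11 := SFI.mem_sharp h11
  replace h22 := SFI.mem_sharp h22
  replace h33 := SFI.mem_sharp h33
  replace h12 := SCB.mem_sharp h12
  replace h34 := SCB.mem_sharp h34
  replace hF20 := SCB.mem_sharp hF20
  replace hF21 := SCB.mem_sharp hF21
  replace hF30 := SCB.mem_sharp hF30
  replace hF31 := SCB.mem_sharp hF31
  simp only [EntryS.pivotsSOK, Bool.and_eq_true] at hok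
  obtain ⟨⟨ok1, ok2⟩, ok3⟩ := hok
  -- d1
  have hd1 := SFI.mem_sharp (SFI.Mem.congr
    (SFI.mem_sub h11 (SFI.mem_const (T := T) (c := c) (FI.mem_ofRat m)))
    (b := fun t => piv1 (E.r11 t) m) fun t => by unfold piv1; rfl)
  have hu1 := SFI.mem_sharp (SFI.mem_recip hd1 ok1)
  -- d2
  have hd2 := SFI.mem_sharp (SFI.Mem.congr
    (SFI.mem_sub h22 (SFI.mem_mul (SCB.mem_normSqS h12) hu1))
    (b := fun t => piv2 (E.r11 t) (E.r22 t) (E.c12 t) m) fun t => by unfold piv2; ring)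
  have hu2 := SFI.mem_sharp (SFI.mem_recip hd2 ok2)
  -- n21, n31
  have hn21 := SCB.mem_sharp (SCB.Mem.congr
    (SCB.mem_sub hF21 (SCB.mem_mulR (SCB.mem_mul hF20 (SCB.mem_conj h12)) hu1))
    (g := fun t => mul21 (E.r11 t) (E.c12 t) (E.F20 t) (E.F21 t) m) fun t => by unfold mul21; rfl)
  have hn31 := SCB.mem_sharp (SCB.Mem.congr
    (SCB.mem_sub hF31 (SCB.mem_mulR (SCB.mem_mul hF30 (SCB.mem_conj h12)) hu1))
    (g := fun t => mul31 (E.r11 t) (E.c12 t) (E.F30 t) (E.F31 t) m) fun t => by unfold mul31; rfl)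
  -- d3
  have hd3 := SFI.mem_sharp (SFI.Mem.congr
    (SFI.mem_sub (SFI.mem_sub h33 (SFI.mem_mul (SCB.mem_normSqS hF20) hu1))
      (SFI.mem_mul (SCB.mem_normSqS hn21) hu2))
    (b := fun t => piv3 (E.r11 t) (E.r22 t) (E.r33 t) (E.c12 t) (E.F20 t) (E.F21 t) m)
    fun t => by unfold piv3; ring)
  have hu3 := SFI.mem_sharp (SFI.mem_recip hd3 ok3)
  -- n32
  have hn32 := SCB.mem_sharp (SCB.Mem.congr
    (SCB.mem_sub (SCB.mem_sub h34 (SCB.mem_mulR (SCB.mem_mul hF30 (SCB.mem_conj hF20)) hu1))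
      (SCB.mem_mulR (SCB.mem_mul hn31 (SCB.mem_conj hn21)) hu2))
    (g := fun t => mul32 (E.r11 t) (E.r22 t) (E.c12 t) (E.c34 t) (E.F20 t) (E.F21 t) (E.F30 t) (E.F31 t) m)
    fun t => by unfold mul32; rfl)
  -- d4
  have hd4 := SFI.Mem.congr
    (SFI.mem_sub (SFI.mem_sub (SFI.mem_sub h22 (SFI.mem_mul (SCB.mem_normSqS hF30) hu1))
      (SFI.mem_mul (SCB.mem_normSqS hn31) hu2)) (SFI.mem_mul (SCB.mem_normSqS hn32) hu3))
    (b := fun t => piv4 (E.r11 t) (E.r22 t) (E.r33 t) (E.c12 t) (E.c34 t) (E.F20 t) (E.F21 t)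
      (E.F30 t) (E.F31 t) m) fun t => by unfold piv4; ring
  exact ⟨hd1, hd2, hd3, hd4⟩

/-- **The sharpened leaf test**: flags ∧ centred-form enclosures of `d₁, d₂, d₃ > 0`, `d₄ ≥ 0`.
[cite: Rump2006, §1] -/
def EntryS.pivotsPosS (S : EntryS) (m : ℚ) (T : FI) (c : ℚ) : Bool :=
  S.pivotsSOK m T c && decide (0 < ((S.pivotsS m T c).d1.encl T c).lo)
    && decide (0 < ((S.pivotsS m T c).d2.encl T c).lo) && decide (0 < ((S.pivotsS m T c).d3.encl T c).lo)
    && decide (0 ≤ ((S.pivotsS m T c).d4.encl T c).lo)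

/-- **Positive semidefiniteness on a whole cell from the sharpened pivots.** [cite: Rump2006, §1] -/
theorem EntryS.posSemidef_on_cell_S {E : EntryF} {S : EntryS} (hS : EntryS.Mem T c E S) {m : ℚ}
    (h : S.pivotsPosS m T c = true) {t : ℝ} (ht : FI.mem t T) : (E.Q m t).PosSemidef := by
  simp only [EntryS.pivotsPosS, Bool.and_eq_true, decide_eq_true_eq] at h
  obtain ⟨⟨⟨⟨hok, h1⟩, h2⟩, h3⟩, h4⟩ := h
  obtain ⟨m1, m2, m3, m4⟩ := EntryS.mem_pivotsS hS hok
  exact QMOf_posSemidef_of_pivots _ _ _ _ _ _ _ _ _ m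
    (pos_of_encl (SFI.mem_encl m1 ht) h1) (pos_of_encl (SFI.mem_encl m2 ht) h2)
    (pos_of_encl (SFI.mem_encl m3 ht) h3) (nonneg_of_encl (SFI.mem_encl m4 ht) h4)

/-- **The margin floor on a whole cell (sharpened leaf)**: for every `t ∈ T` and every `(w₂, w₃, w₄)`
the margin of the entries at `t` is `≥ m`. [cite: Zhang2022LandauSiegel, (2.32), §18] -/
theorem EntryS.blocks_ge_on_cell_S {E : EntryF} {S : EntryS} (hS : EntryS.Mem T c E S) {m : ℚ}
    (h : S.pivotsPosS m T c = true) {t : ℝ} (ht : FI.mem t T) (w2 w3 w4 : ℂ) :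
    (m : ℝ) ≤ ((E.r11 t : ℂ) + w2 * conj (E.c12 t) + conj w2 * E.c12 t
          + (Complex.normSq w2 : ℂ) * (E.r22 t : ℂ)).re
        + ((Complex.normSq w3 : ℂ) * (E.r33 t : ℂ) + w3 * conj w4 * E.c34 t
            + w4 * conj w3 * conj (E.c34 t) + (Complex.normSq w4 : ℂ) * (E.r22 t : ℂ)).re
        + 2 * (conj w3 * E.F20 t + conj w3 * w2 * E.F21 t + conj w4 * E.F30 t
            + conj w4 * w2 * E.F31 t).re :=
  blocks_ge_of_QMOf_posSemidef (EntryS.posSemidef_on_cell_S hS h ht) w2 w3 w4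

end Literature.NumberTheory.LFunctions.Zhang2022
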